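import Mathlib.Tactic.ComputeDegree
import Literature.NumberTheory.EllipticCurves.IsogenyFormulaCert
import Literature.NumberTheory.EllipticCurves.IsogenyFormulaDegree
import Literature.NumberTheory.EllipticCurves.KubertTateFive
import Literature.NumberTheory.EllipticCurves.ConstantKernelIsogenySelmerTrivial
import Literature.NumberTheory.GaloisRepresentations.HeckeCharacterProofs
import HarnessLib

/-!
# The `5`-isogeny of the Kubert–Tate curve `E_{13/14} : y² + xy - 2548y = x³ - 182x²` and the
# vanishing of its `ℤ/5`-Selmer group (a `5`-descent at a good ordinary prime, rank-`2` régime)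

PROOF-ONLY file (theorems and the concrete data as `def`s with bodies), topic
`NumberTheory/EllipticCurves`. The curve is the member `t = 13/14` of the universal family with a
point of order `5` (tree `WeierstrassCurve.kubertTateFive 13 14 = [1, -182, -2548, 0, 0]`, Knapp
(5.31), Kubert 1976 Table 3), `T = (0,0)`, discriminant `Δ = 13⁵·14⁵·(13² - 11·13·14 - 14²) =
-2⁵·7⁵·13⁵·2029`: its bad primes `2, 7, 13, 2029` are all `≢ 1 (mod 5)` and `5 ∤ Δ`, so it lies
in the Kronecker–Weber-free régime of Mazur's étale-kernel descent
(`ConstantKernelDescent.selmerGroup_eq_bot`): this file supplies the explicit Vélu `5`-isogeny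
`φ : E → E' = E/⟨T⟩`, `E' = [1, -182, -2548, -306670, -121427670]`, as a kernel-checked
certificate (tree `IsogenyCert`, exactly as `X1ElevenFiveIsogeny` does for `11A3 → 11A1`), computes
`ker φ = {O, (0,0), (0,2548), (182,0), (182,2366)} = ⟨T̄⟩`, and concludes

* `selmerGroup_fiveIsogeny_eq_bot` — **`Sel^φ(E/ℚ) = 0`**;
* `exists_toGeomPoints_eq` — **`E'(ℚ) = φ(E(ℚ))`**;
* `ker_shaMap_fiveIsogeny_eq_bot` — **`Ш(E/ℚ)[φ] = 0`**.

(The curve has Mordell–Weil rank `2` — points `(-78, 936)`, `(98, 392)` — and `5` is a prime of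
good ORDINARY, anomalous, reduction: `#E(𝔽₅) ∈ {5, 10}`; the `μ₅`-side of the descent and the
rank are treated in the sequel files.)

## References

* [Mazur1977] B. Mazur, *Modular curves and the Eisenstein ideal*, Publ. Math. IHÉS 47 (1977),
  Ch. III §3 (descent through a constant subgroup).
* [Velu1971] J. Vélu, *Isogénies entre courbes elliptiques*, C. R. Acad. Sci. Paris 273 (1971).
* [Kubert1976] D. S. Kubert, *Universal bounds on the torsion of elliptic curves*, Table 3.
* [SilvermanAEC2009] J. H. Silverman, *AEC*, 2nd ed., Thm. III.4.8, Rem. III.4.13.3, X.4.2.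

## Design

The certificate integers were produced by Vélu's formulae (kernel `{(0,0), (182,2366)} ∪ -`,
kernel polynomial `h = x² - 182x`) and are verified by `decide +kernel` (`fiveIsogenyCert_check`);
everything downstream mirrors `X1ElevenFiveIsogeny`.
-/

noncomputable section

open scoped Classical
open Polynomial WeierstrassCurve NumberField IsDedekindDomain Field
open Literature.NumberTheory.EllipticCurves Literature.NumberTheory.EllipticCurves.PolyCert
open Literature.NumberTheory.GaloisRepresentations

namespace Literature.NumberTheory.EllipticCurves

namespace KubertTate1314

/-! ### The curves -/

/-- `E = E_{13/14} = [1, -182, -2548, 0, 0] : y² + xy - 2548 y = x³ - 182 x²`, the Kubert–Tate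
curve `kubertTateFive 13 14`. [cite: Kubert1976, Table 3 (N = 5)] -/
def curveE : WeierstrassCurve ℚ := ⟨1, -182, -2548, 0, 0⟩

/-- The integer model of `E`. [cite: Kubert1976, Table 3 (N = 5)] -/
def curveE₀ : WeierstrassCurve ℤ := ⟨1, -182, -2548, 0, 0⟩

/-- `E' = E/⟨(0,0)⟩ = [1, -182, -2548, -306670, -121427670]` (Vélu). [cite: Velu1971, formulae] -/
def curveE' : WeierstrassCurve ℚ := ⟨1, -182, -2548, -306670, -121427670⟩

/-- Unfolding the coefficients of `E`. [cite: Kubert1976, Table 3 (N = 5)] -/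
@[simp] theorem curveE_a₁ : curveE.a₁ = 1 := rfl
/-- Unfolding the coefficients of `E`. [cite: Kubert1976, Table 3 (N = 5)] -/
@[simp] theorem curveE_a₂ : curveE.a₂ = -182 := rfl
/-- Unfolding the coefficients of `E`. [cite: Kubert1976, Table 3 (N = 5)] -/
@[simp] theorem curveE_a₃ : curveE.a₃ = -2548 := rfl
/-- Unfolding the coefficients of `E`. [cite: Kubert1976, Table 3 (N = 5)] -/
@[simp] theorem curveE_a₄ : curveE.a₄ = 0 := rfl
/-- Unfolding the coefficients of `E`. [cite: Kubert1976, Table 3 (N = 5)] -/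
@[simp] theorem curveE_a₆ : curveE.a₆ = 0 := rfl
/-- Unfolding the coefficients of `E'`. [cite: Kubert1976, Table 3 (N = 5)] -/
@[simp] theorem curveE'_a₁ : curveE'.a₁ = 1 := rfl
/-- Unfolding the coefficients of `E'`. [cite: Kubert1976, Table 3 (N = 5)] -/
@[simp] theorem curveE'_a₂ : curveE'.a₂ = -182 := rfl
/-- Unfolding the coefficients of `E'`. [cite: Kubert1976, Table 3 (N = 5)] -/
@[simp] theorem curveE'_a₃ : curveE'.a₃ = -2548 := rfl
/-- Unfolding the coefficients of `E'`. [cite: Kubert1976, Table 3 (N = 5)] -/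
@[simp] theorem curveE'_a₄ : curveE'.a₄ = -306670 := rfl
/-- Unfolding the coefficients of `E'`. [cite: Kubert1976, Table 3 (N = 5)] -/
@[simp] theorem curveE'_a₆ : curveE'.a₆ = -121427670 := rfl

/-- `E = kubertTateFive 13 14` (`[n - m, -mn, -mn², 0, 0]` with `(m, n) = (13, 14)`).
[cite: Kubert1976, Table 3 (N = 5)] -/
theorem curveE_eq_kubertTateFive : curveE = kubertTateFive (13 : ℚ) 14 := by
  simp only [curveE, kubertTateFive]; norm_num

/-- `E` is the base change of its integer model. [cite: Kubert1976, Table 3 (N = 5)] -/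
theorem curveE_eq_map : curveE = curveE₀.map (Int.castRingHom ℚ) := by
  simp only [curveE, curveE₀, WeierstrassCurve.map]; norm_num

/-- `Δ(E₀) = -405171591170528 = -2⁵·7⁵·13⁵·2029`. [cite: Kubert1976, Table 3 (N = 5)] -/
theorem curveE₀_Δ : curveE₀.Δ = -405171591170528 := by
  norm_num [curveE₀, WeierstrassCurve.Δ, WeierstrassCurve.b₂, WeierstrassCurve.b₄,
    WeierstrassCurve.b₆, WeierstrassCurve.b₈]

/-- `Δ(E) = -405171591170528`. [cite: Kubert1976, Table 3 (N = 5)] -/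
theorem curveE_Δ : curveE.Δ = -405171591170528 := by
  norm_num [curveE, WeierstrassCurve.Δ, WeierstrassCurve.b₂, WeierstrassCurve.b₄,
    WeierstrassCurve.b₆, WeierstrassCurve.b₈]

/-- `Δ(E') = -182 · 2029⁵ = -6258663802904449118`. [cite: Velu1971, formulae] -/
theorem curveE'_Δ : curveE'.Δ = -6258663802904449118 := by
  norm_num [curveE', WeierstrassCurve.Δ, WeierstrassCurve.b₂, WeierstrassCurve.b₄,
    WeierstrassCurve.b₆, WeierstrassCurve.b₈]

/-- `E` is an elliptic curve. [cite: Kubert1976, Table 3 (N = 5)] -/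
instance instIsEllipticCurveE : curveE.IsElliptic :=
  ⟨by rw [curveE_Δ]; exact isUnit_iff_ne_zero.mpr (by norm_num)⟩

/-- `E'` is an elliptic curve. [cite: Velu1971, formulae] -/
instance instIsEllipticCurveE' : curveE'.IsElliptic :=
  ⟨by rw [curveE'_Δ]; exact isUnit_iff_ne_zero.mpr (by norm_num)⟩

/-! ### Vélu's `5`-isogeny as a kernel-checked certificate -/

/-- **The certificate of the `5`-isogeny `E → E'`** (Vélu's formulae for the kernel `⟨(0,0)⟩`,
kernel polynomial `x² - 182x`; coefficient lists, constant term first).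
[cite: Velu1971, formulae; SilvermanAEC2009, Rem. III.4.13.3] -/
def fiveIsogenyCert : IsogenyCert where
  a₁ := 1
  a₂ := -182
  a₃ := -2548
  a₄ := 0
  a₆ := 0
  a₁' := 1
  a₂' := -182
  a₃' := -2548
  a₄' := -306670
  a₆' := -121427670
  U := [215051077696, -2447598608, 1391208, 94458, -364, 1]
  h := [0, -182, 1]
  S := [78278592281344, -1305667257440, 7342795824, -19973772, 38038, -546, 1]
  T := [-99726926566432256, 1722129030189568, -10337812520672, 22787987040, 76052704, -61334]

/-- The certificate checks (both identities of `IsogenyFormula`, `deg h² < deg U`, by the kernel).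
[cite: SilvermanAEC2009, Thm. III.4.8 and Rem. III.4.13.3] -/
theorem fiveIsogenyCert_check : fiveIsogenyCert.check = true := by
  decide +kernel

/-- **Vélu's isogeny formula `E → E'`** as an `IsogenyFormula`. [cite: Velu1971, formulae; SilvermanAEC2009, Thm. III.4.8] -/
def fiveIsogenyFormula : IsogenyFormula curveE curveE' :=
  fiveIsogenyCert.toFormula fiveIsogenyCert_check _ _
    (by simp [curveE, fiveIsogenyCert]) (by simp [curveE', fiveIsogenyCert])

/-- `U = x⁵ - 364x⁴ + 94458x³ + 1391208x² - 2447598608x + 215051077696`. [cite: Velu1971, formulae] -/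
theorem fiveIsogenyFormula_U :
    fiveIsogenyFormula.U = X ^ 5 - 364 * X ^ 4 + 94458 * X ^ 3 + 1391208 * X ^ 2
      - 2447598608 * X + 215051077696 := by
  show (ofList fiveIsogenyCert.U : ℚ[X]) = _
  simp only [fiveIsogenyCert, ofList_cons, ofList_nil, Int.cast_one, Int.cast_neg,
    Int.cast_ofNat, map_one, map_neg, map_ofNat]
  ring

/-- `h = x² - 182x`. [cite: Velu1971, formulae] -/
theorem fiveIsogenyFormula_h : fiveIsogenyFormula.h = X ^ 2 - 182 * X := by
  show (ofList fiveIsogenyCert.h : ℚ[X]) = _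
  simp only [fiveIsogenyCert, ofList_cons, ofList_nil, Int.cast_one, Int.cast_neg, Int.cast_zero,
    Int.cast_ofNat, map_one, map_neg, map_zero, map_ofNat]
  ring

/-- `deg U = 5`. [cite: SilvermanAEC2009, Thm. III.4.10(c) and Rem. III.4.13.3] -/
theorem natDegree_fiveIsogenyFormula_U : fiveIsogenyFormula.U.natDegree = 5 := by
  rw [fiveIsogenyFormula_U]; compute_degree!

/-- `U` and `h` are coprime (explicit Bézout relation: `U(0) ≠ 0 ≠ U(182)`). [cite: SilvermanAEC2009, Thm. III.4.10(c) and Rem. III.4.13.3] -/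
theorem isCoprime_fiveIsogenyFormula_U_h : IsCoprime fiveIsogenyFormula.U fiveIsogenyFormula.h := by
  -- integer Bézout relation `A U + B h = L`, `L = 6614541047773568 = U(0)·182·13²`
  have hL : (30758 + 27 * X : ℚ[X]) * fiveIsogenyFormula.U +
      (-381740982896 - 2225469064 * X + 3941938 * X ^ 2 - 25844 * X ^ 3 - 27 * X ^ 4) *
        fiveIsogenyFormula.h = C (6614541047773568 : ℚ) := by
    rw [fiveIsogenyFormula_U, fiveIsogenyFormula_h, show (C (6614541047773568 : ℚ) : ℚ[X]) =
      (6614541047773568 : ℚ[X]) by norm_num [map_ofNat]]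
    ring
  refine ⟨C (6614541047773568 : ℚ)⁻¹ * (30758 + 27 * X),
    C (6614541047773568 : ℚ)⁻¹ *
      (-381740982896 - 2225469064 * X + 3941938 * X ^ 2 - 25844 * X ^ 3 - 27 * X ^ 4), ?_⟩
  rw [mul_assoc, mul_assoc, ← mul_add, hL, ← map_mul, inv_mul_cancel₀ (by norm_num), map_one]

/-! ### The isogeny `φ : E → E'` and its kernel -/

/-- **The `5`-isogeny `φ : E → E' = E/⟨(0,0)⟩`**, a term of the tree's `Isogeny` (Silverman,
*AEC*, Thm. III.4.8, via `IsogenyFormula.toIsogeny`). [cite: Velu1971, formulae; SilvermanAEC2009, Thm. III.4.8] -/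
def fiveIsogeny : Isogeny curveE curveE' :=
  fiveIsogenyFormula.toIsogeny

/-- Evaluation of `h` over `ℚ̄`: `h(x) = x² - 182x`. [cite: SilvermanAEC2009, Thm. III.4.10(c) and Rem. III.4.13.3] -/
theorem eval_geom_h (x : AlgebraicClosure ℚ) :
    fiveIsogenyFormula.geom.h.eval x = x ^ 2 - 182 * x := by
  show (fiveIsogenyFormula.h.map (algebraMap ℚ (AlgebraicClosure ℚ))).eval x = _
  rw [fiveIsogenyFormula_h]
  simp

/-- Off `h = 0` the value of `φ` is an affine point, in particular non-zero. [cite: SilvermanAEC2009, Thm. III.4.10(c) and Rem. III.4.13.3] -/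
theorem fiveIsogeny_some_ne_zero {x y : AlgebraicClosure ℚ}
    (hxy : (curveE.baseChange (AlgebraicClosure ℚ)).toAffine.Nonsingular x y)
    (hx : x ^ 2 - 182 * x ≠ 0) : fiveIsogeny (Affine.Point.some x y hxy) ≠ 0 := by
  have e := fiveIsogenyFormula.toIsogeny_some hxy (by rwa [eval_geom_h])
  change fiveIsogenyFormula.toIsogeny (Affine.Point.some x y hxy) ≠ 0
  rw [e]
  exact Affine.Point.some_ne_zero _

/-- `Δ(E/ℚ̄) ≠ 0`. [cite: SilvermanAEC2009, Thm. III.4.10(c) and Rem. III.4.13.3] -/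
theorem geom_curveE_Δ_ne_zero : (curveE.baseChange (AlgebraicClosure ℚ)).Δ ≠ 0 := by
  rw [WeierstrassCurve.baseChange, map_Δ, curveE_Δ]; norm_num

/-- The nonsingular `ℚ̄`-points of `E` are the solutions of `y² + xy - 2548y = x³ - 182x²`. [cite: SilvermanAEC2009, Thm. III.4.10(c) and Rem. III.4.13.3] -/
theorem nonsingular_geom_curveE_iff (x y : AlgebraicClosure ℚ) :
    (curveE.baseChange (AlgebraicClosure ℚ)).toAffine.Nonsingular x y ↔
      y ^ 2 + x * y - 2548 * y = x ^ 3 - 182 * x ^ 2 := by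
  rw [← Affine.equation_iff_nonsingular_of_Δ_ne_zero geom_curveE_Δ_ne_zero, Affine.equation_iff]
  simp only [WeierstrassCurve.baseChange, map_a₁, map_a₂, map_a₃, map_a₄, map_a₆, curveE_a₁,
    curveE_a₂, curveE_a₃, curveE_a₄, curveE_a₆, map_zero, map_one, map_neg, map_ofNat]
  constructor <;> intro h <;> linear_combination h

/-- The geometric point `T̄ = (0, 0) ∈ E(ℚ̄)` (the marked point of order `5`). [cite: SilvermanAEC2009, Thm. III.4.10(c) and Rem. III.4.13.3] -/
def Tbar : geomPoints curveE :=
  Affine.Point.some 0 0 ((nonsingular_geom_curveE_iff 0 0).mpr (by norm_num))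

/-- Two affine points with equal coordinates are equal (proof-irrelevant form). [folklore] -/
private theorem some_eq_some_of_eq {R : Type*} [CommRing R] {V : WeierstrassCurve R}
    {x y x' y' : R} (hx : x = x') (hy : y = y') (h : V.toAffine.Nonsingular x y)
    (h' : V.toAffine.Nonsingular x' y') : Affine.Point.some x y h = Affine.Point.some x' y' h' := by
  subst hx hy; rfl

/-- `T̄ ≠ O`. [cite: SilvermanAEC2009, Thm. III.4.10(c) and Rem. III.4.13.3] -/
theorem Tbar_ne_zero : Tbar ≠ 0 :=
  Affine.Point.some_ne_zero _

/-- **The kernel of `φ` lies in `{O, (0,0), (0,2548), (182,0), (182,2366)}`**: an affine geometric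
point in `ker φ` has `h(x) = x² - 182x = 0`, hence `x ∈ {0, 182}`, and then the equation gives
`y ∈ {0, 2548}` resp. `y ∈ {0, 2366}`. [cite: SilvermanAEC2009, Thm. III.4.10(c) and Rem. III.4.13.3] -/
theorem mem_ker_fiveIsogeny_imp {P : geomPoints curveE} (hP : fiveIsogeny P = 0) :
    P = 0 ∨ ∃ (x y : AlgebraicClosure ℚ) (h : _), P = Affine.Point.some x y h ∧
      ((x = 0 ∧ (y = 0 ∨ y = 2548)) ∨ (x = 182 ∧ (y = 0 ∨ y = 2366))) := by
  rcases P with _ | ⟨x, y, hxy⟩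
  · exact Or.inl rfl
  right
  refine ⟨x, y, hxy, rfl, ?_⟩
  have hx : x ^ 2 - 182 * x = 0 := by
    by_contra hx
    exact fiveIsogeny_some_ne_zero hxy hx hP
  have heq : y ^ 2 + x * y - 2548 * y = x ^ 3 - 182 * x ^ 2 := (nonsingular_geom_curveE_iff x y).mp hxy
  have hx' : x = 0 ∨ x = 182 := by
    have : x * (x - 182) = 0 := by linear_combination hx
    rcases mul_eq_zero.mp this with h0 | h1
    · exact Or.inl h0
    · exact Or.inr (by linear_combination h1)
  rcases hx' with rfl | rfl
  · left
    refine ⟨rfl, ?_⟩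
    have hy : y * (y - 2548) = 0 := by linear_combination heq
    rcases mul_eq_zero.mp hy with h0 | h1
    · exact Or.inl h0
    · exact Or.inr (by linear_combination h1)
  · right
    refine ⟨rfl, ?_⟩
    have hy : y * (y - 2366) = 0 := by linear_combination heq
    rcases mul_eq_zero.mp hy with h0 | h1
    · exact Or.inl h0
    · exact Or.inr (by linear_combination h1)

/-- **`#ker φ = 5`** (`= deg U`, Silverman *AEC* III.4.10(c); tree
`IsogenyFormula.degree_toIsogeny`, with `U`, `h` coprime). [cite: SilvermanAEC2009, Thm. III.4.10(c) and Rem. III.4.13.3] -/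
theorem natCard_ker_fiveIsogeny : Nat.card fiveIsogeny.toAddMonoidHom.ker = 5 := by
  have h := fiveIsogenyFormula.degree_toIsogeny
    (isCoprime_fiveIsogenyFormula_U_h.map (Polynomial.mapRingHom (algebraMap ℚ (AlgebraicClosure ℚ))))
  rw [natDegree_fiveIsogenyFormula_U] at h
  exact h

/-- **`5 • P = O` for every `P ∈ ker φ`** (the kernel has order `5`). [cite: SilvermanAEC2009, Thm. III.4.10(c) and Rem. III.4.13.3] -/
theorem five_nsmul_eq_zero_of_mem_ker {P : geomPoints curveE} (hP : P ∈ fiveIsogeny.toAddMonoidHom.ker) :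
    (5 : ℕ) • P = 0 := by
  haveI : Finite fiveIsogeny.toAddMonoidHom.ker := fiveIsogeny.finite_ker'
  have h := addOrderOf_dvd_natCard (⟨P, hP⟩ : fiveIsogeny.toAddMonoidHom.ker)
  rw [natCard_ker_fiveIsogeny, AddSubgroup.addOrderOf_mk] at h
  exact addOrderOf_dvd_iff_nsmul_eq_zero.mp h

/-- **The kernel points are integral**: a non-zero `P ∈ ker φ` is `(a, b)` with
`(a, b) ∈ {(0,0), (0,2548), (182,0), (182,2366)} ⊂ ℤ²`. [cite: SilvermanAEC2009, Thm. III.4.10(c) and Rem. III.4.13.3] -/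
theorem exists_int_of_mem_ker (P : geomPoints curveE) (hP : P ∈ fiveIsogeny.toAddMonoidHom.ker)
    (hP0 : P ≠ 0) :
    ∃ (a b : ℤ) (h : (curveE.baseChange (AlgebraicClosure ℚ)).toAffine.Nonsingular
      (a : AlgebraicClosure ℚ) (b : AlgebraicClosure ℚ)), P = Affine.Point.some _ _ h := by
  have hP' : fiveIsogeny P = 0 := hP
  rcases mem_ker_fiveIsogeny_imp hP' with rfl | ⟨x, y, h, rfl, hxy⟩
  · exact absurd rfl hP0
  rcases hxy with ⟨rfl, rfl | rfl⟩ | ⟨rfl, rfl | rfl⟩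
  · exact ⟨0, 0, (nonsingular_geom_curveE_iff _ _).mpr (by push_cast; norm_num),
      some_eq_some_of_eq (by push_cast; rfl) (by push_cast; rfl) _ _⟩
  · exact ⟨0, 2548, (nonsingular_geom_curveE_iff _ _).mpr (by push_cast; norm_num),
      some_eq_some_of_eq (by push_cast; rfl) (by push_cast; rfl) _ _⟩
  · exact ⟨182, 0, (nonsingular_geom_curveE_iff _ _).mpr (by push_cast; norm_num),
      some_eq_some_of_eq (by push_cast; rfl) (by push_cast; rfl) _ _⟩
  · exact ⟨182, 2366, (nonsingular_geom_curveE_iff _ _).mpr (by push_cast; norm_num),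
      some_eq_some_of_eq (by push_cast; rfl) (by push_cast; rfl) _ _⟩

/-- **The kernel is constant**: `Γ_ℚ` fixes every point of `ker φ` (all five are rational).
[cite: Mazur1977, Ch. III §3 (the constant subgroup C)] -/
theorem smul_eq_of_mem_ker (σ : absoluteGaloisGroup ℚ) (P : geomPoints curveE)
    (hP : P ∈ fiveIsogeny.toAddMonoidHom.ker) : σ • P = P := by
  by_cases hP0 : P = 0
  · rw [hP0, smul_zero]
  obtain ⟨a, b, h, rfl⟩ := exists_int_of_mem_ker P hP hP0
  letI : Algebra ℚ (AlgebraicClosure ℚ) := AlgebraicClosure.instAlgebra ℚ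
  set τ : AlgebraicClosure ℚ ≃ₐ[ℚ] AlgebraicClosure ℚ := absoluteGaloisGroup.toAlgEquiv ℚ σ with hτ
  have e := Affine.Point.map_some (W' := curveE.toAffine)
    (τ : AlgebraicClosure ℚ →ₐ[ℚ] AlgebraicClosure ℚ) h
  exact e.trans (some_eq_some_of_eq (map_intCast _ a) (map_intCast _ b) _ _)

/-! ### The primes: `5 ∤ Δ`, and every bad prime is `≢ 1 (mod 5)` -/

/-- `2029` is prime. [cite: Kubert1976, Table 3 (N = 5)] -/
theorem prime_2029 : Nat.Prime 2029 := by norm_num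

/-- A prime dividing `405171591170528 = 2⁵·7⁵·13⁵·2029` is one of `2, 7, 13, 2029`. [cite: Kubert1976, Table 3 (N = 5)] -/
theorem eq_of_prime_dvd_Δ {p : ℕ} (hp : p.Prime) (hdvd : p ∣ 405171591170528) :
    p = 2 ∨ p = 7 ∨ p = 13 ∨ p = 2029 := by
  have hfac : (405171591170528 : ℕ) = 2 ^ 5 * 7 ^ 5 * 13 ^ 5 * 2029 := by norm_num
  rw [hfac] at hdvd
  rcases (Nat.Prime.dvd_mul hp).mp hdvd with h1 | h2029
  · rcases (Nat.Prime.dvd_mul hp).mp h1 with h2 | h13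
    · rcases (Nat.Prime.dvd_mul hp).mp h2 with h3 | h7
      · exact Or.inl ((Nat.prime_dvd_prime_iff_eq hp Nat.prime_two).mp (hp.dvd_of_dvd_pow h3))
      · exact Or.inr (Or.inl ((Nat.prime_dvd_prime_iff_eq hp (by norm_num)).mp
          (hp.dvd_of_dvd_pow h7)))
    · exact Or.inr (Or.inr (Or.inl ((Nat.prime_dvd_prime_iff_eq hp (by norm_num)).mp
        (hp.dvd_of_dvd_pow h13))))
  · exact Or.inr (Or.inr (Or.inr ((Nat.prime_dvd_prime_iff_eq hp prime_2029).mp h2029)))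

/-- **The place-by-place hypothesis of the étale/tame descent for `E`**: every finite place `v` of
`ℚ` is étale for `E₀` (`Δ(E₀) ∉ v`) or tame for `n = 5` (`5 ∉ v` and `gcd(5, N v - 1) = 1`):
the primes of `Δ = -2⁵·7⁵·13⁵·2029` are `2, 7, 13, 2029 ≢ 0, 1 (mod 5)`.
[cite: Mazur1977, Ch. I §1(g)] -/
theorem etale_or_tame (v : HeightOneSpectrum (𝓞 ℚ)) :
    ((curveE₀.Δ : ℤ) : 𝓞 ℚ) ∉ v.asIdeal ∨
      (((5 : ℕ) : 𝓞 ℚ) ∉ v.asIdeal ∧ Nat.Coprime 5 (v.residueCard - 1)) := by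
  set p := Rat.HeightOneSpectrum.natGenerator v with hp
  have hpp : p.Prime := Rat.HeightOneSpectrum.prime_natGenerator v
  by_cases hdvd : (p : ℤ) ∣ curveE₀.Δ
  · right
    rw [curveE₀_Δ] at hdvd
    have hdvd' : p ∣ 405171591170528 := by
      have := Int.natAbs_dvd_natAbs.mpr hdvd
      simpa using this
    have hres : v.residueCard = p := Rat.residueCard_eq_natGenerator v
    rw [Rat.natCast_mem_asIdeal_iff, hres, ← hp]
    rcases eq_of_prime_dvd_Δ hpp hdvd' with h | h | h | h <;> rw [h] <;> norm_num
  · left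
    rwa [Rat.intCast_mem_asIdeal_iff, ← hp]

/-! ### Conclusions: `Sel^φ(E/ℚ) = 0`, `E'(ℚ) = φ(E(ℚ))`, `Ш(E/ℚ)[φ] = 0` -/

/-- **`Sel^φ(E/ℚ) = 0`** for the `5`-isogeny `φ : E_{13/14} → E_{13/14}/⟨(0,0)⟩`: the `ℤ/5`-side
of the `5`-descent is empty (Mazur's étale-kernel descent in the tame régime,
`ConstantKernelDescent.selmerGroup_eq_bot`: kernel constant and integral, `5 ∤ Δ`, bad primes
`2, 7, 13, 2029 ≢ 1 (mod 5)`). [cite: Mazur1977, Ch. III §3 Thm. (3.1) with Ch. I §1(g)] -/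
theorem selmerGroup_fiveIsogeny_eq_bot : fiveIsogeny.selmerGroup = ⊥ :=
  ConstantKernelDescent.selmerGroup_eq_bot fiveIsogeny curveE₀ curveE_eq_map
    (fun σ P hP ↦ smul_eq_of_mem_ker σ P hP) exists_int_of_mem_ker (n := 5) (by norm_num)
    (fun P hP ↦ five_nsmul_eq_zero_of_mem_ker hP) etale_or_tame

/-- **`E'(ℚ) = φ(E(ℚ))`**: every rational point of `E' = [1, -182, -2548, -306670, -121427670]` is
the image of a rational point of `E`. [cite: SilvermanAEC2009, Thm. X.4.2(a)] -/
theorem exists_toGeomPoints_eq (P' : curveE'.toAffine.Point) :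
    ∃ P : curveE.toAffine.Point, curveE'.toGeomPoints P' = fiveIsogeny (curveE.toGeomPoints P) :=
  ConstantKernelDescent.exists_toGeomPoints_eq_of_selmerGroup_eq_bot fiveIsogeny
    selmerGroup_fiveIsogeny_eq_bot P'

/-- **`Ш(E/ℚ)[φ] = 0`**: the kernel of `Ш(φ) : Ш(E/ℚ) → Ш(E'/ℚ)` is trivial.
[cite: SilvermanAEC2009, Thm. X.4.2(a)] -/
theorem ker_shaMap_fiveIsogeny_eq_bot :
    (shaMap fiveIsogeny.toAddMonoidHom fiveIsogeny.equivariant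
      fiveIsogeny.hasLocalPointsMaps_toAddMonoidHom).ker = ⊥ :=
  ConstantKernelDescent.ker_shaMap_eq_bot_of_selmerGroup_eq_bot fiveIsogeny
    selmerGroup_fiveIsogeny_eq_bot

end KubertTate1314

end Literature.NumberTheory.EllipticCurves

end
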